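import Summits.HubbardSuperconductivity.HubbardSuperconductivity.Theorems.BirComplexStableXY.Negative.WitnessTable
import Literature.MathematicalPhysics.QuantumFieldTheory.TphiSeminormExp
import HarnessLib

/-!
# Crux `BirComplexStableXYR` (stmt-HubbardSuperconductivity-14845), line `fat-gaussian-defect-calculus`:
# stub G2 `stub_tphiSeminorm_char_le` — the `T_φ` seminorm of a window character

Helper (`--supports`) for the crux
`Summit.HubbardSuperconductivity.HubbardSuperconductivity.Theses.BalabanIR.BirComplexStableXYR`, line
`fat-gaussian-defect-calculus` (lead skeleton `Cruxes/BirComplexStableXYR/Lines/fat_gaussian_defect_calculus.lean`,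
lead c8, wave 9), registered stub G2 `stub_tphiSeminorm_char_le` (chapter 2).

**Statement.** Assume the generic bound G1 for continuous linear functionals (hypothesis `hlin`):
`‖ℓ‖_{T_φ(𝔥)} ≤ ‖ℓ φ‖ + 𝔥‖ℓ‖` for every `ℓ : E →L[ℝ] ℂ` on every real normed space `E`.  Then for every
frequency `n : W r → ℤ` on the window `W r = Fin r × Fin r × Fin r` (vocabulary of
`Theorems.BirComplexStableXY.Negative.WitnessTable`), every Taylor order `N`, every `𝔥 ≥ 0` and every field
`u : W r → ℝ` (sup norm), the window character `χ_n(φ) = exp(i Σ_w n_w φ_w)` satisfies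
`‖χ_n‖_{T_φ(𝔥), u} ≤ exp(𝔥 Σ_w |n_w|)` (BBS `T_φ` seminorm `tphiSeminorm`, `Literature/…/TphiSeminorm.lean`).

**Proof.** `χ_n = exp ∘ ℓ` for the continuous `ℝ`-linear functional `ℓ(φ) = i Σ_w n_w φ_w : (W r → ℝ) →L[ℝ] ℂ`,
built with `LinearMap.mkContinuous` from the bound `‖ℓ φ‖ = |Σ_w n_w φ_w| ≤ (Σ_w |n_w|)‖φ‖_∞`
(`|φ_w| ≤ ‖φ‖`, `norm_le_pi_norm`), whence `‖ℓ‖ ≤ Σ_w |n_w|` (`LinearMap.mkContinuous_norm_le`).  The landed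
exponential estimate `tphiSeminorm_cexp_le` (`TphiSeminormExp.lean`, BBS Lemma 7.4.1) gives
`‖e^ℓ‖_{T_φ,u} ≤ e^{Re ℓ(u)} · e^{‖ℓ‖_{T_φ,u} − ‖ℓ(u)‖}`; here `Re ℓ(u) = 0` (`ℓ` is purely imaginary) and, by
`hlin`, `‖ℓ‖_{T_φ,u} − ‖ℓ(u)‖ ≤ 𝔥‖ℓ‖ ≤ 𝔥 Σ_w |n_w|`; monotonicity of `exp` finishes.  No definition and no named
fact is introduced; sorry-free. [folklore]
-/

set_option linter.dupNamespace false -- `Summit.<S>.<S>.Theorems…` repeats the summit name (D-0017 layout)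

noncomputable section

namespace Summit.HubbardSuperconductivity.HubbardSuperconductivity.Theorems.FSUnfolding

open scoped BigOperators ComplexConjugate
open Literature.MathematicalPhysics.QuantumFieldTheory Literature.Probability.LatticeModels
open Summit.HubbardSuperconductivity.BirComplexStableXYNegative

/-- **The character exponent as a continuous linear functional.**  For a frequency `n : W r → ℤ` there is a
continuous `ℝ`-linear `ℓ : (W r → ℝ) →L[ℝ] ℂ` with `ℓ φ = i·Σ_w n_w φ_w` and operator norm (for the sup norm on
`W r → ℝ`) at most `Σ_w |n_w|`. [folklore] -/
theorem hsc_charCLM_exists (r : ℕ) (n : Freq r) :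
    ∃ ℓ : (W r → ℝ) →L[ℝ] ℂ, (∀ φ : W r → ℝ, ℓ φ = Complex.I * ((∑ w, (n w : ℝ) * φ w : ℝ) : ℂ)) ∧
      ‖ℓ‖ ≤ ∑ w, |(n w : ℝ)| := by
  let L : (W r → ℝ) →ₗ[ℝ] ℂ :=
    { toFun := fun φ => Complex.I * ((∑ w, (n w : ℝ) * φ w : ℝ) : ℂ)
      map_add' := fun x y => by
        have hs : ∑ w, (n w : ℝ) * (x + y) w = (∑ w, (n w : ℝ) * x w) + ∑ w, (n w : ℝ) * y w := by
          rw [← Finset.sum_add_distrib]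
          exact Finset.sum_congr rfl fun w _ => by rw [Pi.add_apply, mul_add]
        rw [hs, Complex.ofReal_add, mul_add]
      map_smul' := fun c x => by
        have hs : ∑ w, (n w : ℝ) * (c • x) w = c * ∑ w, (n w : ℝ) * x w := by
          rw [Finset.mul_sum]
          exact Finset.sum_congr rfl fun w _ => by rw [Pi.smul_apply, smul_eq_mul]; ring
        rw [hs, RingHom.id_apply, Complex.real_smul, Complex.ofReal_mul]
        ring }
  have hbound : ∀ φ : W r → ℝ, ‖L φ‖ ≤ (∑ w, |(n w : ℝ)|) * ‖φ‖ := by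
    intro φ
    show ‖Complex.I * ((∑ w, (n w : ℝ) * φ w : ℝ) : ℂ)‖ ≤ (∑ w, |(n w : ℝ)|) * ‖φ‖
    rw [norm_mul, Complex.norm_I, one_mul, Complex.norm_real, Real.norm_eq_abs, Finset.sum_mul]
    refine (Finset.abs_sum_le_sum_abs _ _).trans (Finset.sum_le_sum fun w _ => ?_)
    rw [abs_mul]
    have hw : |φ w| ≤ ‖φ‖ := by
      have h := norm_le_pi_norm φ w
      rwa [Real.norm_eq_abs] at h
    exact mul_le_mul_of_nonneg_left hw (abs_nonneg _)
  exact ⟨L.mkContinuous _ hbound, fun φ => rfl,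
    L.mkContinuous_norm_le (Finset.sum_nonneg fun w _ => abs_nonneg _) hbound⟩

/-- **stub G2: `T_φ` seminorm of a character.**  Given the generic linear-functional bound G1 (hypothesis), for
every frequency `n` the window character `u ↦ exp(i·Σ_w n_w u_w)` satisfies `‖·‖_{T_φ(𝔥),u} ≤ e^{𝔥·Σ_w|n_w|}` at
every `u` (`tphiSeminorm_cexp_le` with the purely imaginary linear exponent `F = i·(n·u)`: `e^{Re F} = 1`, and
`‖F‖_{T_φ,u} − ‖F u‖ ≤ 𝔥‖F‖_{op} ≤ 𝔥|n|₁` for the sup norm on `W r → ℝ`). [folklore] -/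
theorem stub_tphiSeminorm_char_le :
    (∀ (E : Type) [NormedAddCommGroup E] [NormedSpace ℝ E] (ℓ : E →L[ℝ] ℂ) (N : ℕ) (𝔥 : ℝ), 0 ≤ 𝔥 →
      ∀ φ : E, tphiSeminorm N 𝔥 (fun x => ℓ x) φ ≤ ‖ℓ φ‖ + 𝔥 * ‖ℓ‖) →
    ∀ (r : ℕ) (n : Freq r) (N : ℕ) (𝔥 : ℝ), 0 ≤ 𝔥 → ∀ u : W r → ℝ,
      tphiSeminorm N 𝔥 (fun φ : W r → ℝ => Complex.exp (Complex.I * ((∑ w, (n w : ℝ) * φ w : ℝ) : ℂ))) u ≤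
        Real.exp (𝔥 * ∑ w, |(n w : ℝ)|) := by
  intro hlin r n N 𝔥 h𝔥 u
  obtain ⟨ℓ, hℓ, hnorm⟩ := hsc_charCLM_exists r n
  have hfun : (fun φ : W r → ℝ => Complex.exp (Complex.I * ((∑ w, (n w : ℝ) * φ w : ℝ) : ℂ))) =
      fun φ : W r → ℝ => Complex.exp (ℓ φ) := by
    funext φ
    rw [hℓ]
  rw [hfun]
  have hF : ContDiff ℝ N (fun x : W r → ℝ => ℓ x) := ℓ.contDiff
  have h1 : tphiSeminorm N 𝔥 (fun x : W r → ℝ => Complex.exp (ℓ x)) u ≤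
      Real.exp (ℓ u).re * Real.exp (tphiSeminorm N 𝔥 (fun x : W r → ℝ => ℓ x) u - ‖ℓ u‖) :=
    tphiSeminorm_cexp_le N h𝔥 hF u
  have hre : (ℓ u).re = 0 := by
    rw [hℓ, Complex.I_mul_re, Complex.ofReal_im, neg_zero]
  have h2 : tphiSeminorm N 𝔥 (fun x : W r → ℝ => ℓ x) u ≤ ‖ℓ u‖ + 𝔥 * ‖ℓ‖ := hlin (W r → ℝ) ℓ N 𝔥 h𝔥 u
  have h3 : tphiSeminorm N 𝔥 (fun x : W r → ℝ => ℓ x) u - ‖ℓ u‖ ≤ 𝔥 * ∑ w, |(n w : ℝ)| := by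
    have h4 : 𝔥 * ‖ℓ‖ ≤ 𝔥 * ∑ w, |(n w : ℝ)| := mul_le_mul_of_nonneg_left hnorm h𝔥
    linarith
  calc tphiSeminorm N 𝔥 (fun x : W r → ℝ => Complex.exp (ℓ x)) u
      ≤ Real.exp (ℓ u).re * Real.exp (tphiSeminorm N 𝔥 (fun x : W r → ℝ => ℓ x) u - ‖ℓ u‖) := h1
    _ ≤ Real.exp (𝔥 * ∑ w, |(n w : ℝ)|) := by
        rw [hre, Real.exp_zero, one_mul]
        exact Real.exp_le_exp.2 h3

end Summit.HubbardSuperconductivity.HubbardSuperconductivity.Theorems.FSUnfolding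

end
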